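import Summits.Ventures.CertifiedManyBodySolver.Downfold.EmeryAxialFermiVelocity
import HarnessLib

/-!
# THE AXIAL ORBITAL DILUTES, IT DOES NOT REDISTRIBUTE: on every Fermi point of the four-orbital (d, s, pₓ, p_y; t_pp, t_pp′) model the Cu-4s weight is
# `w_s = a′·axialLin/W4 a′` (zero at the node, positive elsewhere on the zone contour) and the Cu-d weight is the FROZEN σ weight times `(1 − w_s)`:
# `w_d⁽⁴⁾ = minorD(t̄)/W4 a′ = w_d^σ(t̄)·(1 − w_s)` — the d : p ratio of the non-s weight is exactly the σ model's

Venture CertifiedManyBodySolver, cell `pub/hubbard-downfold` (stage S1; INFLATION-RULES-3to1-B §B.78 — the U leg of the 3 → 1 reduction on AXIAL materials),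
seat hubbard-downfold-mod-4 (technique B, g31); namespace `Summit.Ventures.CertifiedManyBodySolver.Downfold.Emery`. Sequel of `EmeryOrbitalWeight` (3 × 3: `dWeight =
minorD/(minorD + minorX + minorY)` IS `|ψ_d|²` on the contour, adjugate-column proof), `EmerySecularFormDefectAxial` (§B.66: `sec4`, `dsec4`, fixed-Fermi-surface split
`(t̄ − α, α)`, `W4 a′`, `dsec4_eq_W4`) and `EmeryAxialFermiVelocity` (§B.77: `axialLin ≥ 0` on zone contours, `= 0` exactly at the node). Everything PROVED (0 sorry;
`simp`/`ring` determinant identities + sign bookkeeping). WHAT THIS IS NOT: a statement about any material; `U = 0` one-body eigenvector weights of the four-orbital model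
of [AndersenEtAl1995]/[PavariniEtAl2001] with the O–O hoppings of [HybertsenSchluterChristensen1989]; correlated spectral weight is not touched.

* §1 PRINCIPAL MINORS OF `H₄ − ε` (`secularPP`): `minor4D = (ε_s − ε)·minorD + T·axialP` (`axialP = 4(Δ + ε)(x + y) − 32(t_pp − t_pp′)xy = ∂_a minorD`,
  `minorD_coshift`), `minor4S = −charCubic`, `minor4X = (ε_s − ε)·minorX + 4Tεy`, `minor4Y = (ε_s − ε)·minorY + 4Tεx`; **their sum is `dsec4`** (`sum_minors4_eq_dsec4`,
  the trace of the adjugate = minus the energy derivative of `det(H₄ − ε) = −sec4`); each is a LEVEL DERIVATIVE of the determinant (`det_secularPP_shiftD/S`: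
  `det(H₄ + δ·E_jj − ε) = −sec4 + δ·minor4j`, Hellmann–Feynman: `w_j = ∂E/∂ε_j = minor4j/dsec4`).
* §2 THE EIGENVECTOR: the adjugate column `adjCol4` satisfies `(H₄ − ε)·adjCol4 = −sec4·e_d` (`secularPP_mulVec_adjCol4`) — a null vector on the contour — and the JACOBI
  identities `adjCol4ⱼ² = minor4D·minor4j + sec4·(complementary 2 × 2 minor)` (`adjCol4_sq_s/x/y`); hence ON THE CONTOUR `|ψ_j|² = minor4j/dsec4`
  (`sWeight4_eq_component_ratio`, `dWeight4_eq_component_ratio`): the weights `sWeight4 = minor4S/dsec4`, `dWeight4 = minor4D/dsec4` ARE the Bloch-state weights.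
* §3 FIXED-FERMI-SURFACE CLOSED FORMS (frozen couplings `t̄ = (t_pp, t_pp′)`, direct part `t̄ − α`, `T = α(ε_s − ε)`, slope `a′ = α/(ε_s − ε)`, contour `charCubic(t̄) = 0`):
  `minor4S = α·axialLin(t̄)` (`minor4S_fixedFS`), `minor4D = (ε_s − ε)·minorD(t̄)` (`minor4D_fixedFS`: the `axialP` terms cancel identically), so
  **`w_s = a′·axialLin(t̄)/W4 a′`** (`sWeight4_fixedFS`) and **`w_d⁽⁴⁾ = minorD(t̄)/W4 a′ = w_d^σ(t̄)·(1 − w_s)`** (`dWeight4_fixedFS`, `dWeight4_eq_dWeight_mul`): THE AXIAL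
  ORBITAL DILUTES the σ weights by the common factor `1 − w_s(k)` — the d : p partition of the non-s weight at every Fermi point is exactly the frozen σ model's
  (`pWeight4_eq`); with §B.77 `w_s` is the Möbius function `a′(γ₀ + 8γ₁s)/(α₄ + 8β₄s)` of the harmonic (`sWeight4_harmonic`).
* §4 SIGNS ON ZONE CONTOURS: `w_s ≥ 0` at every zone Fermi point, `= 0` at the node, `> 0` beyond it (`sWeight4_nonneg_on_zone`, `sWeight4_node`, `sWeight4_pos_of_node_lt`);
  **`w_d⁽⁴⁾ ≤ w_d^σ(t̄)`** everywhere, equality at the node, strict beyond it, and `a′ ↦ w_d⁽⁴⁾` STRICTLY DECREASING beyond the node (`dWeight4_le_dWeight_on_zone`,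
  `dWeight4_node`, `dWeight4_lt_dWeight`, `dWeight4_strictAnti_slope`): on an axial material the band-level U-leg weights of §B.72 are the co-shifted σ weights times
  `(1 − w_s(k))`, largest reduction at the antinode ([PavariniEtAl2001]: «Cu s character … of order 10 per cent at (π, 0)» ⇒ `U_B ∝ w²` down by ≈ 20 % there), none at the node.

Sources: four-orbital model [AndersenEtAl1995, Eq. (1), §§6–7]; axial orbital [PavariniEtAl2001, Eqs. (1)–(3)]; three-band model [HybertsenSchluterChristensen1989,
Eq. (1)]; Jacobi's complementary-minor identity and Hellmann–Feynman [folklore].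
-/

noncomputable section

namespace Summit.Ventures.CertifiedManyBodySolver.Downfold.Emery

open Real Set Matrix

/-! ## §1 Principal minors of `H₄ − ε` and their sum -/

/-- `axialP = 4(Δ + ε)(x + y) − 32(t_pp − t_pp′)·xy` — the co-shift derivative of `minorD` (and the `T`-coefficient of `minor4D`). [folklore] -/
def axialP (Δ tpp c x y ε : ℝ) : ℝ := 4 * (Δ + ε) * (x + y) - 32 * (tpp - c) * (x * y)

/-- `minorD(t_pp + a, t_pp′ + a) = minorD + a·axialP` (the `a²` terms cancel). [folklore] -/
theorem minorD_coshift (Δ tpp c a x y ε : ℝ) : minorD Δ (tpp + a) (c + a) x y ε = minorD Δ tpp c x y ε + a * axialP Δ tpp c x y ε := by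
  unfold minorD axialP; ring

/-- `axialP` is co-shift invariant. [folklore] -/
theorem axialP_coshift (Δ tpp c a x y ε : ℝ) : axialP Δ (tpp + a) (c + a) x y ε = axialP Δ tpp c x y ε := by
  unfold axialP; ring

/-- `minorX Δ t_pd (t_pp′ + a) y ε = minorX + 4aεy`. [folklore] -/
theorem minorX_coshift (Δ tpd c a y ε : ℝ) : minorX Δ tpd (c + a) y ε = minorX Δ tpd c y ε + 4 * a * ε * y := by
  unfold minorX; ring

/-- `minorY Δ t_pd (t_pp′ + a) x ε = minorY + 4aεx`. [folklore] -/
theorem minorY_coshift (Δ tpd c a x ε : ℝ) : minorY Δ tpd (c + a) x ε = minorY Δ tpd c x ε + 4 * a * ε * x := by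
  unfold minorY; ring

/-- Principal minor of `H₄ − ε` deleting the `d` row/column (the `(s, pₓ, p_y)` block): `minor4D = (ε_s − ε)·minorD + T·axialP` (`T = t_sp²`). [folklore] -/
def minor4D (Δ εs tpp c T x y ε : ℝ) : ℝ := (εs - ε) * minorD Δ tpp c x y ε + T * axialP Δ tpp c x y ε

/-- Principal minor deleting the `s` row/column (the σ block): `minor4S = det(bloch4 − ε) = −charCubic`. [folklore] -/
def minor4S (Δ tpd tpp c x y ε : ℝ) : ℝ := -charCubic Δ tpd tpp c x y ε

/-- Principal minor deleting the `pₓ` row/column: `minor4X = (ε_s − ε)·minorX + 4Tεy`. [folklore] -/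
def minor4X (Δ εs tpd c T y ε : ℝ) : ℝ := (εs - ε) * minorX Δ tpd c y ε + 4 * T * ε * y

/-- Principal minor deleting the `p_y` row/column: `minor4Y = (ε_s − ε)·minorY + 4Tεx`. [folklore] -/
def minor4Y (Δ εs tpd c T x ε : ℝ) : ℝ := (εs - ε) * minorY Δ tpd c x ε + 4 * T * ε * x

/-- **TRACE OF THE ADJUGATE = ENERGY DERIVATIVE**: `minor4D + minor4S + minor4X + minor4Y = dsec4`. [folklore] -/
theorem sum_minors4_eq_dsec4 (Δ εs tpd tpp c T x y ε : ℝ) :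
    minor4D Δ εs tpp c T x y ε + minor4S Δ tpd tpp c x y ε + minor4X Δ εs tpd c T y ε + minor4Y Δ εs tpd c T x ε = dsec4 Δ εs tpd tpp c T x y ε := by
  unfold minor4D minor4S minor4X minor4Y dsec4 axialP daxialLin
  rw [← sum_minors_eq_dcharCubic]
  ring

/-- `H₄ − ε` with the Cu-d LEVEL shifted by `δ`. [folklore] -/
def secularPPshiftD (Δ εs tpd tpp c tsp sx sy ε δ : ℝ) : Matrix (Fin 4) (Fin 4) ℝ :=
  !![-ε + δ, 0, 2 * tpd * sx, -2 * tpd * sy;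
     0, εs - ε, 2 * tsp * sx, 2 * tsp * sy;
     2 * tpd * sx, 2 * tsp * sx, -Δ - 4 * c * sx ^ 2 - ε, -4 * tpp * sx * sy;
     -2 * tpd * sy, 2 * tsp * sy, -4 * tpp * sx * sy, -Δ - 4 * c * sy ^ 2 - ε]

/-- HELLMANN–FEYNMAN FORM OF `minor4D`: `det(H₄ + δE_dd − ε) = −sec4 + δ·minor4D` — `minor4D` is the derivative of the determinant in the d LEVEL, so on the band
`∂E/∂ε_d = minor4D/dsec4 = w_d`. [folklore] -/
theorem det_secularPPshiftD (Δ εs tpd tpp c tsp sx sy ε δ : ℝ) :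
    (secularPPshiftD Δ εs tpd tpp c tsp sx sy ε δ).det = -sec4 Δ εs tpd tpp c (tsp ^ 2) (sx ^ 2) (sy ^ 2) ε + δ * minor4D Δ εs tpp c (tsp ^ 2) (sx ^ 2) (sy ^ 2) ε := by
  simp [secularPPshiftD, Matrix.det_succ_row_zero, Fin.sum_univ_succ, Fin.succAbove, sec4, charCubic, axialLin, minor4D, minorD, axialP]
  ring

/-- `H₄ − ε` with the Cu-s LEVEL shifted by `δ`. [folklore] -/
def secularPPshiftS (Δ εs tpd tpp c tsp sx sy ε δ : ℝ) : Matrix (Fin 4) (Fin 4) ℝ :=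
  !![-ε, 0, 2 * tpd * sx, -2 * tpd * sy;
     0, εs - ε + δ, 2 * tsp * sx, 2 * tsp * sy;
     2 * tpd * sx, 2 * tsp * sx, -Δ - 4 * c * sx ^ 2 - ε, -4 * tpp * sx * sy;
     -2 * tpd * sy, 2 * tsp * sy, -4 * tpp * sx * sy, -Δ - 4 * c * sy ^ 2 - ε]

/-- HELLMANN–FEYNMAN FORM OF `minor4S`: `det(H₄ + δE_ss − ε) = −sec4 + δ·minor4S` (`∂sec4/∂ε_s = charCubic`: the four-orbital secular function is AFFINE in the axial
level). [folklore] -/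
theorem det_secularPPshiftS (Δ εs tpd tpp c tsp sx sy ε δ : ℝ) :
    (secularPPshiftS Δ εs tpd tpp c tsp sx sy ε δ).det = -sec4 Δ εs tpd tpp c (tsp ^ 2) (sx ^ 2) (sy ^ 2) ε + δ * minor4S Δ tpd tpp c (sx ^ 2) (sy ^ 2) ε := by
  simp [secularPPshiftS, Matrix.det_succ_row_zero, Fin.sum_univ_succ, Fin.succAbove, sec4, charCubic, axialLin, minor4S]
  ring

/-! ## §2 The eigenvector: adjugate column and Jacobi identities -/

/-- The `d`-column of the adjugate of `H₄ − ε` (entries `d, s, pₓ, p_y`), with `P = 2t_pd sx`, `Q = 2t_pd sy`, `R = 2t_sp sx`, `S = 2t_sp sy`, `w = ε_s − ε`,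
`X = −Δ − 4t_pp′sx² − ε`, `Y = −Δ − 4t_pp′sy² − ε`, `B = 4t_pp sx sy`: `(minor4D, RPY − RBQ + SPB − SQX, −w(PY − BQ) + S(PS + RQ), −wPB + wQX − RPS − R²Q)`. [folklore] -/
def adjCol4 (Δ εs tpd tpp c tsp sx sy ε : ℝ) : Fin 4 → ℝ :=
  ![minor4D Δ εs tpp c (tsp ^ 2) (sx ^ 2) (sy ^ 2) ε,
    (2 * tsp * sx) * (2 * tpd * sx) * (-Δ - 4 * c * sy ^ 2 - ε) - (2 * tsp * sx) * (4 * tpp * sx * sy) * (2 * tpd * sy)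
      + (2 * tsp * sy) * (2 * tpd * sx) * (4 * tpp * sx * sy) - (2 * tsp * sy) * (2 * tpd * sy) * (-Δ - 4 * c * sx ^ 2 - ε),
    -(εs - ε) * ((2 * tpd * sx) * (-Δ - 4 * c * sy ^ 2 - ε) - (4 * tpp * sx * sy) * (2 * tpd * sy))
      + (2 * tsp * sy) * ((2 * tpd * sx) * (2 * tsp * sy) + (2 * tsp * sx) * (2 * tpd * sy)),
    -(εs - ε) * (2 * tpd * sx) * (4 * tpp * sx * sy) + (εs - ε) * (2 * tpd * sy) * (-Δ - 4 * c * sx ^ 2 - ε)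
      - (2 * tsp * sx) * (2 * tpd * sx) * (2 * tsp * sy) - (2 * tsp * sx) ^ 2 * (2 * tpd * sy)]

/-- **`(H₄ − ε)·adjCol4 = −sec4·e_d`**: the adjugate column is an eigenvector candidate whose defect is the four-orbital secular function. [folklore] -/
theorem secularPP_mulVec_adjCol4 (Δ εs tpd tpp c tsp sx sy ε : ℝ) :
    secularPP Δ εs tpd tpp c tsp sx sy ε *ᵥ adjCol4 Δ εs tpd tpp c tsp sx sy ε = ![-sec4 Δ εs tpd tpp c (tsp ^ 2) (sx ^ 2) (sy ^ 2) ε, 0, 0, 0] := by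
  ext i
  fin_cases i <;>
    simp [secularPP, adjCol4, minor4D, minorD, axialP, sec4, charCubic, axialLin, Matrix.mulVec, dotProduct, Fin.sum_univ_four] <;> ring

/-- ON THE CONTOUR `adjCol4` is a null vector of `H₄ − ε` (an eigenvector with eigenvalue `ε` when non-zero). [folklore] -/
theorem secularPP_mulVec_adjCol4_eq_zero {Δ εs tpd tpp c tsp sx sy ε : ℝ} (hP : sec4 Δ εs tpd tpp c (tsp ^ 2) (sx ^ 2) (sy ^ 2) ε = 0) :
    secularPP Δ εs tpd tpp c tsp sx sy ε *ᵥ adjCol4 Δ εs tpd tpp c tsp sx sy ε = 0 := by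
  rw [secularPP_mulVec_adjCol4, hP, neg_zero]
  ext i; fin_cases i <;> simp

/-- JACOBI (d, s): `adjCol4ₛ² = minor4D·minor4S + sec4·minorD(direct)` — on the contour `|v_s|² = minor4D·minor4S`. [folklore] -/
theorem adjCol4_sq_s (Δ εs tpd tpp c tsp sx sy ε : ℝ) :
    adjCol4 Δ εs tpd tpp c tsp sx sy ε 1 ^ 2 =
      minor4D Δ εs tpp c (tsp ^ 2) (sx ^ 2) (sy ^ 2) ε * minor4S Δ tpd tpp c (sx ^ 2) (sy ^ 2) ε
        + sec4 Δ εs tpd tpp c (tsp ^ 2) (sx ^ 2) (sy ^ 2) ε * minorD Δ tpp c (sx ^ 2) (sy ^ 2) ε := by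
  simp [adjCol4, minor4D, minor4S, minorD, axialP, sec4, charCubic, axialLin]
  ring

/-- JACOBI (d, pₓ): `adjCol4ₓ² = minor4D·minor4X + sec4·[(ε_s − ε)(−Δ − 4t_pp′y − ε) − 4t_sp²y]`. [folklore] -/
theorem adjCol4_sq_x (Δ εs tpd tpp c tsp sx sy ε : ℝ) :
    adjCol4 Δ εs tpd tpp c tsp sx sy ε 2 ^ 2 =
      minor4D Δ εs tpp c (tsp ^ 2) (sx ^ 2) (sy ^ 2) ε * minor4X Δ εs tpd c (tsp ^ 2) (sy ^ 2) ε
        + sec4 Δ εs tpd tpp c (tsp ^ 2) (sx ^ 2) (sy ^ 2) ε * ((εs - ε) * (-Δ - 4 * c * sy ^ 2 - ε) - 4 * tsp ^ 2 * sy ^ 2) := by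
  simp [adjCol4, minor4D, minor4X, minorD, minorX, axialP, sec4, charCubic, axialLin]
  ring

/-- JACOBI (d, p_y): `adjCol4_y² = minor4D·minor4Y + sec4·[(ε_s − ε)(−Δ − 4t_pp′x − ε) − 4t_sp²x]`. [folklore] -/
theorem adjCol4_sq_y (Δ εs tpd tpp c tsp sx sy ε : ℝ) :
    adjCol4 Δ εs tpd tpp c tsp sx sy ε 3 ^ 2 =
      minor4D Δ εs tpp c (tsp ^ 2) (sx ^ 2) (sy ^ 2) ε * minor4Y Δ εs tpd c (tsp ^ 2) (sx ^ 2) ε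
        + sec4 Δ εs tpd tpp c (tsp ^ 2) (sx ^ 2) (sy ^ 2) ε * ((εs - ε) * (-Δ - 4 * c * sx ^ 2 - ε) - 4 * tsp ^ 2 * sx ^ 2) := by
  simp [adjCol4, minor4D, minor4Y, minorD, minorY, axialP, sec4, charCubic, axialLin]
  ring

/-- **The Cu-4s weight function** `w_s = minor4S/dsec4 = −charCubic/dsec4` (`= |ψ_s|²` on the contour, `= ∂E/∂ε_s` by Hellmann–Feynman). [folklore] -/
def sWeight4 (Δ εs tpd tpp c T x y ε : ℝ) : ℝ := minor4S Δ tpd tpp c x y ε / dsec4 Δ εs tpd tpp c T x y ε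

/-- **The Cu-d weight function of the four-orbital band** `w_d⁽⁴⁾ = minor4D/dsec4`. [folklore] -/
def dWeight4 (Δ εs tpd tpp c T x y ε : ℝ) : ℝ := minor4D Δ εs tpp c T x y ε / dsec4 Δ εs tpd tpp c T x y ε

/-- ON THE CONTOUR `‖adjCol4‖² = minor4D·dsec4`. [folklore] -/
theorem adjCol4_normSq {Δ εs tpd tpp c tsp sx sy ε : ℝ} (hP : sec4 Δ εs tpd tpp c (tsp ^ 2) (sx ^ 2) (sy ^ 2) ε = 0) :
    adjCol4 Δ εs tpd tpp c tsp sx sy ε 0 ^ 2 + adjCol4 Δ εs tpd tpp c tsp sx sy ε 1 ^ 2 + adjCol4 Δ εs tpd tpp c tsp sx sy ε 2 ^ 2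
        + adjCol4 Δ εs tpd tpp c tsp sx sy ε 3 ^ 2 =
      minor4D Δ εs tpp c (tsp ^ 2) (sx ^ 2) (sy ^ 2) ε * dsec4 Δ εs tpd tpp c (tsp ^ 2) (sx ^ 2) (sy ^ 2) ε := by
  rw [adjCol4_sq_s, adjCol4_sq_x, adjCol4_sq_y, hP, ← sum_minors4_eq_dsec4]
  have h0 : adjCol4 Δ εs tpd tpp c tsp sx sy ε 0 = minor4D Δ εs tpp c (tsp ^ 2) (sx ^ 2) (sy ^ 2) ε := rfl
  rw [h0]; ring

/-- **ON THE CONTOUR `sWeight4` IS the normalised `|ψ_s|²` of the Bloch eigenvector** (`minor4D ≠ 0`). [folklore] -/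
theorem sWeight4_eq_component_ratio {Δ εs tpd tpp c tsp sx sy ε : ℝ} (hP : sec4 Δ εs tpd tpp c (tsp ^ 2) (sx ^ 2) (sy ^ 2) ε = 0)
    (hD : minor4D Δ εs tpp c (tsp ^ 2) (sx ^ 2) (sy ^ 2) ε ≠ 0) :
    adjCol4 Δ εs tpd tpp c tsp sx sy ε 1 ^ 2 /
        (adjCol4 Δ εs tpd tpp c tsp sx sy ε 0 ^ 2 + adjCol4 Δ εs tpd tpp c tsp sx sy ε 1 ^ 2 + adjCol4 Δ εs tpd tpp c tsp sx sy ε 2 ^ 2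
          + adjCol4 Δ εs tpd tpp c tsp sx sy ε 3 ^ 2) = sWeight4 Δ εs tpd tpp c (tsp ^ 2) (sx ^ 2) (sy ^ 2) ε := by
  rw [adjCol4_normSq hP, adjCol4_sq_s, hP, zero_mul, add_zero, sWeight4, mul_div_mul_left _ _ hD]

/-- **ON THE CONTOUR `dWeight4` IS the normalised `|ψ_d|²`** (`minor4D ≠ 0`). [folklore] -/
theorem dWeight4_eq_component_ratio {Δ εs tpd tpp c tsp sx sy ε : ℝ} (hP : sec4 Δ εs tpd tpp c (tsp ^ 2) (sx ^ 2) (sy ^ 2) ε = 0)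
    (hD : minor4D Δ εs tpp c (tsp ^ 2) (sx ^ 2) (sy ^ 2) ε ≠ 0) :
    adjCol4 Δ εs tpd tpp c tsp sx sy ε 0 ^ 2 /
        (adjCol4 Δ εs tpd tpp c tsp sx sy ε 0 ^ 2 + adjCol4 Δ εs tpd tpp c tsp sx sy ε 1 ^ 2 + adjCol4 Δ εs tpd tpp c tsp sx sy ε 2 ^ 2
          + adjCol4 Δ εs tpd tpp c tsp sx sy ε 3 ^ 2) = dWeight4 Δ εs tpd tpp c (tsp ^ 2) (sx ^ 2) (sy ^ 2) ε := by
  have h0 : adjCol4 Δ εs tpd tpp c tsp sx sy ε 0 = minor4D Δ εs tpp c (tsp ^ 2) (sx ^ 2) (sy ^ 2) ε := rfl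
  rw [adjCol4_normSq hP, h0, dWeight4, sq, mul_div_mul_left _ _ hD]

/-! ## §3 Fixed-Fermi-surface closed forms: the axial orbital dilutes -/

/-- FIXED FERMI SURFACE (frozen `t̄`, direct part `t̄ − α`, contour `charCubic(t̄) = 0`): `minor4S(direct) = α·axialLin(t̄)`. [folklore] -/
theorem minor4S_fixedFS {Δ tpd tpp c α x y ε : ℝ} (hP : charCubic Δ tpd tpp c x y ε = 0) :
    minor4S Δ tpd (tpp - α) (c - α) x y ε = α * axialLin Δ tpd tpp c x y ε := by
  unfold minor4S
  have h1 : charCubic Δ tpd (tpp - α) (c - α) x y ε = charCubic Δ tpd tpp c x y ε + (-α) * axialLin Δ tpd tpp c x y ε := by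
    rw [← charCubic_coshift]; ring_nf
  rw [h1, hP]; ring

/-- FIXED FERMI SURFACE: `minor4D(direct, T) = (ε_s − ε)·minorD(t̄)` with `T = α(ε_s − ε)` — the `axialP` terms cancel identically (no contour hypothesis). [folklore] -/
theorem minor4D_fixedFS (Δ εs tpp c α T x y ε : ℝ) (hT : T = α * (εs - ε)) :
    minor4D Δ εs (tpp - α) (c - α) T x y ε = (εs - ε) * minorD Δ tpp c x y ε := by
  unfold minor4D
  have h1 : minorD Δ (tpp - α) (c - α) x y ε = minorD Δ tpp c x y ε + (-α) * axialP Δ tpp c x y ε := by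
    rw [← minorD_coshift]; ring_nf
  have h2 : axialP Δ (tpp - α) (c - α) x y ε = axialP Δ tpp c x y ε := by
    rw [← axialP_coshift Δ (tpp - α) (c - α) α]; ring_nf
  rw [h1, h2, hT]; ring

/-- **THE Cu-4s WEIGHT IN CLOSED FORM**: `w_s = a′·axialLin(t̄)/W4 a′` with `a′ = α/(ε_s − ε)` (`ε ≠ ε_s`, frozen contour). [cite: PavariniEtAl2001, text after Eq. (3)
(«Cu s-character proportional to v²»)] -/
theorem sWeight4_fixedFS {Δ εs tpd tpp c α T x y ε : ℝ} (hε : εs - ε ≠ 0) (hT : T = α * (εs - ε)) (hP : charCubic Δ tpd tpp c x y ε = 0) :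
    sWeight4 Δ εs tpd (tpp - α) (c - α) T x y ε = (α / (εs - ε)) * axialLin Δ tpd tpp c x y ε / W4 Δ tpd tpp c (α / (εs - ε)) x y ε := by
  unfold sWeight4
  rw [minor4S_fixedFS hP, dsec4_eq_W4 Δ εs tpd tpp c α T x y ε hε hT hP]
  field_simp

/-- **THE Cu-d WEIGHT IN CLOSED FORM**: `w_d⁽⁴⁾ = minorD(t̄)/W4 a′` — the FROZEN σ numerator over the four-orbital energy denominator. [folklore] -/
theorem dWeight4_fixedFS {Δ εs tpd tpp c α T x y ε : ℝ} (hε : εs - ε ≠ 0) (hT : T = α * (εs - ε)) (hP : charCubic Δ tpd tpp c x y ε = 0) :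
    dWeight4 Δ εs tpd (tpp - α) (c - α) T x y ε = minorD Δ tpp c x y ε / W4 Δ tpd tpp c (α / (εs - ε)) x y ε := by
  unfold dWeight4
  rw [minor4D_fixedFS Δ εs tpp c α T x y ε hT, dsec4_eq_W4 Δ εs tpd tpp c α T x y ε hε hT hP, mul_div_mul_left _ _ hε]

/-- **THE AXIAL ORBITAL DILUTES**: `w_d⁽⁴⁾ = w_d^σ(t̄)·(1 − w_s)` — the Cu-d share of the NON-s weight is exactly the frozen σ model's
(`∂_ε charCubic(t̄) ≠ 0`, `W4 ≠ 0`). [folklore] -/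
theorem dWeight4_eq_dWeight_mul {Δ εs tpd tpp c α T x y ε : ℝ} (hε : εs - ε ≠ 0) (hT : T = α * (εs - ε)) (hP : charCubic Δ tpd tpp c x y ε = 0)
    (hWσ : dcharCubic Δ tpd tpp c x y ε ≠ 0) (hW4 : W4 Δ tpd tpp c (α / (εs - ε)) x y ε ≠ 0) :
    dWeight4 Δ εs tpd (tpp - α) (c - α) T x y ε = dWeight Δ tpd tpp c x y ε * (1 - sWeight4 Δ εs tpd (tpp - α) (c - α) T x y ε) := by
  rw [dWeight4_fixedFS hε hT hP, sWeight4_fixedFS hε hT hP, dWeight_eq_div_dcharCubic]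
  have hsub : 1 - α / (εs - ε) * axialLin Δ tpd tpp c x y ε / W4 Δ tpd tpp c (α / (εs - ε)) x y ε =
      dcharCubic Δ tpd tpp c x y ε / W4 Δ tpd tpp c (α / (εs - ε)) x y ε := by
    rw [eq_div_iff hW4, sub_mul, div_mul_cancel₀ _ hW4, one_mul]
    unfold W4; ring
  rw [hsub, div_mul_div_comm, mul_comm (minorD Δ tpp c x y ε) (dcharCubic Δ tpd tpp c x y ε), mul_div_mul_left _ _ hWσ]

/-- The oxygen weight is diluted by the same factor: `1 − w_d⁽⁴⁾ − w_s = (1 − w_d^σ(t̄))·(1 − w_s)`. [folklore] -/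
theorem pWeight4_eq {Δ εs tpd tpp c α T x y ε : ℝ} (hε : εs - ε ≠ 0) (hT : T = α * (εs - ε)) (hP : charCubic Δ tpd tpp c x y ε = 0)
    (hWσ : dcharCubic Δ tpd tpp c x y ε ≠ 0) (hW4 : W4 Δ tpd tpp c (α / (εs - ε)) x y ε ≠ 0) :
    1 - dWeight4 Δ εs tpd (tpp - α) (c - α) T x y ε - sWeight4 Δ εs tpd (tpp - α) (c - α) T x y ε =
      (1 - dWeight Δ tpd tpp c x y ε) * (1 - sWeight4 Δ εs tpd (tpp - α) (c - α) T x y ε) := by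
  rw [dWeight4_eq_dWeight_mul hε hT hP hWσ hW4]; ring

/-- THE s WEIGHT ALONG THE CONTOUR IS A MÖBIUS FUNCTION OF THE HARMONIC: `w_s = a′(γ₀ + 8γ₁·s)/(α₄ + 8β₄·s)` (frozen contour, `fsT ≠ 0`; §B.77's `γ₀, γ₁, α₄, β₄`).
[folklore] -/
theorem sWeight4_harmonic {Δ εs tpd tpp c α T x y ε : ℝ} (hε : εs - ε ≠ 0) (hT : T = α * (εs - ε)) (hP : charCubic Δ tpd tpp c x y ε = 0)
    (hTf : fsT Δ tpd tpp c ε ≠ 0) :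
    sWeight4 Δ εs tpd (tpp - α) (c - α) T x y ε =
      (α / (εs - ε)) * (axialGamma0 Δ tpd tpp c ε + 8 * axialGamma1 Δ tpd tpp c ε * tpHarm x y)
        / (alpha4 Δ tpd tpp c (α / (εs - ε)) ε + 8 * beta4 Δ tpd tpp c (α / (εs - ε)) ε * tpHarm x y) := by
  rw [sWeight4_fixedFS hε hT hP, ← fsT_mul_W4 (α / (εs - ε)) hP]
  have h2 := fsT_mul_axialLin_sub Δ tpd tpp c x y ε
  rw [hP, mul_zero, sub_zero] at h2
  rw [← h2]
  field_simp

/-! ## §4 Signs on zone contours: the s weight is non-negative and vanishes only at the node; the d weight is diluted, most at the antinode -/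

/-- `w_s ≥ 0` at every ZONE Fermi point (`α ≥ 0`, `ε < ε_s`, positive four-orbital denominator; regime of `axialLin_nonneg_on_zone`). [folklore] -/
theorem sWeight4_nonneg_on_zone {Δ εs tpd tpp c α T x y ε : ℝ} (hεs : ε < εs) (hα : 0 ≤ α) (hT : T = α * (εs - ε))
    (hP : charCubic Δ tpd tpp c x y ε = 0) (hN : 0 < fsN tpd tpp c ε) (hD : 0 < fsD Δ tpd c ε) (hε : 0 ≤ ε) (hN1 : fsN1 tpd tpp c ε ≠ 0)
    (hγ : 0 < axialGamma1 Δ tpd tpp c ε) (hW4 : 0 < W4 Δ tpd tpp c (α / (εs - ε)) x y ε) (hx : x ∈ Set.Icc (0 : ℝ) 1) (hy : y ∈ Set.Icc (0 : ℝ) 1) :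
    0 ≤ sWeight4 Δ εs tpd (tpp - α) (c - α) T x y ε := by
  have hw : 0 < εs - ε := sub_pos.2 hεs
  rw [sWeight4_fixedFS hw.ne' hT hP]
  have hax := axialLin_nonneg_on_zone hP hN hD hε hN1 hγ hx hy
  have : 0 ≤ α / (εs - ε) := div_nonneg hα hw.le
  positivity

/-- AT THE NODE `w_s = 0` for every slope (`fsN1 ≠ 0`, `ε ≠ ε_s`). [folklore] -/
theorem sWeight4_node {Δ εs tpd tpp c α T ε : ℝ} (hε : εs - ε ≠ 0) (hT : T = α * (εs - ε)) (hN1 : fsN1 tpd tpp c ε ≠ 0) :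
    sWeight4 Δ εs tpd (tpp - α) (c - α) T (xNode Δ tpd tpp c ε) (xNode Δ tpd tpp c ε) ε = 0 := by
  rw [sWeight4_fixedFS hε hT (charCubic_xNode (Δ := Δ) hN1), axialLin_xNode hN1, mul_zero, zero_div]

/-- BEYOND THE NODE `w_s > 0` (`α > 0`, `ε < ε_s`, `x + y > 2xNode`, positive denominators). [folklore] -/
theorem sWeight4_pos_of_node_lt {Δ εs tpd tpp c α T x y ε : ℝ} (hεs : ε < εs) (hα : 0 < α) (hT : T = α * (εs - ε))
    (hP : charCubic Δ tpd tpp c x y ε = 0) (hTf : 0 < fsT Δ tpd tpp c ε) (hN : 0 < fsN tpd tpp c ε) (hN1 : fsN1 tpd tpp c ε ≠ 0)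
    (hγ : 0 < axialGamma1 Δ tpd tpp c ε) (hW4 : 0 < W4 Δ tpd tpp c (α / (εs - ε)) x y ε) (hs : 2 * xNode Δ tpd tpp c ε < x + y) :
    0 < sWeight4 Δ εs tpd (tpp - α) (c - α) T x y ε := by
  have hw : 0 < εs - ε := sub_pos.2 hεs
  rw [sWeight4_fixedFS hw.ne' hT hP]
  have hax := axialLin_pos_of_node_lt hP hTf hN hN1 hγ hs
  positivity

/-- **`w_d⁽⁴⁾ ≤ w_d^σ(t̄)` AT EVERY ZONE FERMI POINT** (`α ≥ 0`, `ε < ε_s`, σ d-weight non-negative, positive σ denominator; regime of `axialLin_nonneg_on_zone`). [folklore] -/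
theorem dWeight4_le_dWeight_on_zone {Δ εs tpd tpp c α T x y ε : ℝ} (hεs : ε < εs) (hα : 0 ≤ α) (hT : T = α * (εs - ε))
    (hP : charCubic Δ tpd tpp c x y ε = 0) (hN : 0 < fsN tpd tpp c ε) (hD : 0 < fsD Δ tpd c ε) (hε : 0 ≤ ε) (hN1 : fsN1 tpd tpp c ε ≠ 0)
    (hγ : 0 < axialGamma1 Δ tpd tpp c ε) (hWσ : 0 < dcharCubic Δ tpd tpp c x y ε) (hmd : 0 ≤ minorD Δ tpp c x y ε)
    (hx : x ∈ Set.Icc (0 : ℝ) 1) (hy : y ∈ Set.Icc (0 : ℝ) 1) :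
    dWeight4 Δ εs tpd (tpp - α) (c - α) T x y ε ≤ dWeight Δ tpd tpp c x y ε := by
  have hw : 0 < εs - ε := sub_pos.2 hεs
  have hax := axialLin_nonneg_on_zone hP hN hD hε hN1 hγ hx hy
  have ha' : 0 ≤ α / (εs - ε) := div_nonneg hα hw.le
  have hW4 : dcharCubic Δ tpd tpp c x y ε ≤ W4 Δ tpd tpp c (α / (εs - ε)) x y ε := by unfold W4; nlinarith [mul_nonneg ha' hax]
  rw [dWeight4_fixedFS hw.ne' hT hP, dWeight_eq_div_dcharCubic]
  exact div_le_div_of_nonneg_left hmd hWσ hW4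

/-- AT THE NODE `w_d⁽⁴⁾ = w_d^σ(t̄)` for every slope (`fsN1 ≠ 0`, `ε ≠ ε_s`). [folklore] -/
theorem dWeight4_node {Δ εs tpd tpp c α T ε : ℝ} (hε : εs - ε ≠ 0) (hT : T = α * (εs - ε)) (hN1 : fsN1 tpd tpp c ε ≠ 0) :
    dWeight4 Δ εs tpd (tpp - α) (c - α) T (xNode Δ tpd tpp c ε) (xNode Δ tpd tpp c ε) ε =
      dWeight Δ tpd tpp c (xNode Δ tpd tpp c ε) (xNode Δ tpd tpp c ε) ε := by
  rw [dWeight4_fixedFS hε hT (charCubic_xNode (Δ := Δ) hN1), W4_node _ hN1, dWeight_eq_div_dcharCubic]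

/-- **BEYOND THE NODE THE AXIAL ORBITAL STRICTLY LOWERS THE Cu-d WEIGHT**: `α > 0`, `x + y > 2xNode`, `minorD(t̄) > 0`, positive σ denominator ⇒ `w_d⁽⁴⁾ < w_d^σ(t̄)`.
[folklore] -/
theorem dWeight4_lt_dWeight {Δ εs tpd tpp c α T x y ε : ℝ} (hεs : ε < εs) (hα : 0 < α) (hT : T = α * (εs - ε))
    (hP : charCubic Δ tpd tpp c x y ε = 0) (hTf : 0 < fsT Δ tpd tpp c ε) (hN : 0 < fsN tpd tpp c ε) (hN1 : fsN1 tpd tpp c ε ≠ 0)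
    (hγ : 0 < axialGamma1 Δ tpd tpp c ε) (hWσ : 0 < dcharCubic Δ tpd tpp c x y ε) (hmd : 0 < minorD Δ tpp c x y ε)
    (hs : 2 * xNode Δ tpd tpp c ε < x + y) :
    dWeight4 Δ εs tpd (tpp - α) (c - α) T x y ε < dWeight Δ tpd tpp c x y ε := by
  have hw : 0 < εs - ε := sub_pos.2 hεs
  have hax := axialLin_pos_of_node_lt hP hTf hN hN1 hγ hs
  have ha' : 0 < α / (εs - ε) := div_pos hα hw
  have hW4 : dcharCubic Δ tpd tpp c x y ε < W4 Δ tpd tpp c (α / (εs - ε)) x y ε := by unfold W4; nlinarith [mul_pos ha' hax]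
  rw [dWeight4_fixedFS hw.ne' hT hP, dWeight_eq_div_dcharCubic]
  exact div_lt_div_of_pos_left hmd hWσ hW4

/-- **STRICTLY DECREASING IN THE SLOPE**: at a fixed frozen contour point beyond the node, a larger admixture slope `a′ = α/(ε_s − ε)` gives a smaller Cu-d weight
(stated for two splittings `α₁ < α₂` at the same `ε_s`; `minorD(t̄) > 0`, positive denominators). [folklore] -/
theorem dWeight4_strictAnti_slope {Δ εs tpd tpp c α₁ α₂ T₁ T₂ x y ε : ℝ} (hεs : ε < εs) (h12 : α₁ < α₂) (hT₁ : T₁ = α₁ * (εs - ε)) (hT₂ : T₂ = α₂ * (εs - ε))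
    (hP : charCubic Δ tpd tpp c x y ε = 0) (hTf : 0 < fsT Δ tpd tpp c ε) (hN : 0 < fsN tpd tpp c ε) (hN1 : fsN1 tpd tpp c ε ≠ 0)
    (hγ : 0 < axialGamma1 Δ tpd tpp c ε) (hW₁ : 0 < W4 Δ tpd tpp c (α₁ / (εs - ε)) x y ε) (hmd : 0 < minorD Δ tpp c x y ε)
    (hs : 2 * xNode Δ tpd tpp c ε < x + y) :
    dWeight4 Δ εs tpd (tpp - α₂) (c - α₂) T₂ x y ε < dWeight4 Δ εs tpd (tpp - α₁) (c - α₁) T₁ x y ε := by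
  have hw : 0 < εs - ε := sub_pos.2 hεs
  have hax := axialLin_pos_of_node_lt hP hTf hN hN1 hγ hs
  have hlt : α₁ / (εs - ε) < α₂ / (εs - ε) := div_lt_div_of_pos_right h12 hw
  have hW₂ : W4 Δ tpd tpp c (α₁ / (εs - ε)) x y ε < W4 Δ tpd tpp c (α₂ / (εs - ε)) x y ε := by
    unfold W4; nlinarith [mul_pos (sub_pos.2 hlt) hax]
  rw [dWeight4_fixedFS hw.ne' hT₁ hP, dWeight4_fixedFS hw.ne' hT₂ hP]
  exact div_lt_div_of_pos_left hmd hW₁ hW₂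

/-! ## §5 (appended) THE s WEIGHT IS THE VELOCITY DEFICIT: `w_s(k) = 1 − t⁽⁴⁾(k)/t_σ(k)`; at the antinode `w_s = (δ₄ − δ_σ)/(1 + δ₄)` — the axial account of a
one-band form defect `δ₄` (router/EMERY-FORM-DEFECT.tsv: `1 + δ₄ = W4(an)/W4(node)`, `1 + δ_σ = ∂_ε charCubic(an)/∂_ε charCubic(node)`) IMPLIES an antinodal Cu-4s weight -/

/-- `1 − w_s = ∂_ε charCubic(t̄)/W4 a′` (frozen contour, `ε ≠ ε_s`, `W4 ≠ 0`). [folklore] -/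
theorem one_sub_sWeight4_fixedFS {Δ εs tpd tpp c α T x y ε : ℝ} (hε : εs - ε ≠ 0) (hT : T = α * (εs - ε)) (hP : charCubic Δ tpd tpp c x y ε = 0)
    (hW4 : W4 Δ tpd tpp c (α / (εs - ε)) x y ε ≠ 0) :
    1 - sWeight4 Δ εs tpd (tpp - α) (c - α) T x y ε = dcharCubic Δ tpd tpp c x y ε / W4 Δ tpd tpp c (α / (εs - ε)) x y ε := by
  rw [sWeight4_fixedFS hε hT hP, eq_div_iff hW4, sub_mul, div_mul_cancel₀ _ hW4, one_mul]
  unfold W4; ring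

/-- **THE s WEIGHT IS THE VELOCITY DEFICIT**: `w_s(k) = 1 − t⁽⁴⁾(a′; k)/t_σ(k)` — the Cu-4s weight of the Bloch state at a Fermi point equals the relative reduction of the
velocity-matched one-band `t` by the axial channel at that point (`fsT ≠ 0`, non-zero denominators). [folklore] -/
theorem sWeight4_eq_one_sub_scale_ratio {Δ εs tpd tpp c α T x y ε : ℝ} (hε : εs - ε ≠ 0) (hT : T = α * (εs - ε)) (hP : charCubic Δ tpd tpp c x y ε = 0)
    (hTf : fsT Δ tpd tpp c ε ≠ 0) (hW4 : W4 Δ tpd tpp c (α / (εs - ε)) x y ε ≠ 0) :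
    sWeight4 Δ εs tpd (tpp - α) (c - α) T x y ε = 1 - scaleT4 Δ tpd tpp c (α / (εs - ε)) x y ε / scaleT Δ tpd tpp c x y ε := by
  have h := one_sub_sWeight4_fixedFS hε hT hP hW4
  have e : scaleT4 Δ tpd tpp c (α / (εs - ε)) x y ε / scaleT Δ tpd tpp c x y ε = dcharCubic Δ tpd tpp c x y ε / W4 Δ tpd tpp c (α / (εs - ε)) x y ε := by
    unfold scaleT4 scaleT
    rw [div_div_div_comm, div_self hTf, one_div_div]
  rw [e, ← h]; ring

/-- **AT ANY FERMI POINT `w_s(k) = 1 − (1 + δ_σ(k))/(1 + δ₄(k))`** with the node-normalised denominators `1 + δ₄(k) = W4 a′(k)/W4 a′(node)` and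
`1 + δ_σ(k) = ∂_ε charCubic(k)/∂_ε charCubic(node)` (the node is blind, `W4_node`): the AXIAL ACCOUNT of a one-band antinodal form defect `δ₄` implies the antinodal
Cu-4s weight `(δ₄ − δ_σ)/(1 + δ₄)` — e.g. `δ₄ = 0.2` at `δ_σ ≈ 0` reads `w_s(an) ≈ 1/6` (`fsN1 ≠ 0`, non-zero denominators). [folklore] -/
theorem sWeight4_eq_formDefect_share {Δ εs tpd tpp c α T x y ε : ℝ} (hε : εs - ε ≠ 0) (hT : T = α * (εs - ε)) (hP : charCubic Δ tpd tpp c x y ε = 0)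
    (hN1 : fsN1 tpd tpp c ε ≠ 0) (hWn : dcharCubic Δ tpd tpp c (xNode Δ tpd tpp c ε) (xNode Δ tpd tpp c ε) ε ≠ 0)
    (hW4 : W4 Δ tpd tpp c (α / (εs - ε)) x y ε ≠ 0) :
    sWeight4 Δ εs tpd (tpp - α) (c - α) T x y ε =
      1 - (dcharCubic Δ tpd tpp c x y ε / dcharCubic Δ tpd tpp c (xNode Δ tpd tpp c ε) (xNode Δ tpd tpp c ε) ε) /
        (W4 Δ tpd tpp c (α / (εs - ε)) x y ε / W4 Δ tpd tpp c (α / (εs - ε)) (xNode Δ tpd tpp c ε) (xNode Δ tpd tpp c ε) ε) := by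
  rw [W4_node _ hN1, div_div_div_cancel_right₀ hWn, ← one_sub_sWeight4_fixedFS hε hT hP hW4]
  ring

end Summit.Ventures.CertifiedManyBodySolver.Downfold.Emery
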